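/-
Copyright: pub-balaban β-flow team, β-FLOW PROVER 4 (unit `b2b-balaban-beta-bflow-p4`, gen 16; coordinator ruling «YM
ACCELERATION» 2026-08-21 item (2), «work behind the as-printed interface»).  NON-VACUITY OF THE PERMUTATION BLOCK OF PARTs 29d ∕ 29e:
the family of PARTs 29h ∕ 29i (the 2^d cubes of side m with corner coordinates 1 or N−1−m — a set stable under the axis PERMUTATIONS as
well, π_σ s = s∘σ⁻¹) with its ultralocal kernels satisfies the permutation binders too: the supports pull back by (y,ℓ′) ↦ (y∘σ, sort(σ⁻¹ℓ′))
INTO the support of the permuted cube (`hSπ`), π_{σ⁻¹} inverts π_σ (`hππ`), and the Hessians are TRANSPORTED along (πA)_c(y) = A_{σ⁻¹c}(y∘σ)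
(`hHπ`).  With PART 29i (reflections, potentials, non-zero total) the whole point-group block of the END is inhabited by one non-trivial
family.  Lattice bookkeeping; nothing of Bałaban's asserted; NOT N5 for the model, NOT BetaPertH, NOT continuum, NOT Clay.
-/
import Mathlib
import Summits.QuantumFields.BalabanUV.Beta.EriceCurvatureFormHessianCovarianceWitness

/-!
# `Beta.EriceCurvatureFormHessianCovarianceWitnessPerm` — PART 29j of the `EriceLoopExpansionD4` series: the cube family of PARTs 29h ∕ 29i
# inhabits the permutation block of PARTs 29d ∕ 29e

Source: T. Bałaban, Commun. Math. Phys. **109** (1987) [Balaban1987RG1] (5.2)–(5.3) p. 292, (5.6) p. 292; T. Bałaban, A. Jaffe,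
*Constructive gauge theory* (Erice 1985) [BalabanJaffe1986], Part III (3.38)–(3.40) p. 245, (3.65) p. 249; this lineage's PART 29d
`EriceCurvatureFormHessianCovarianceTorus.totals_permCovariant_of_hessianPermutation` (the block witnessed: binders `π` ∕ `hπD` ∕ `hππ` ∕ `hSπ` ∕
`hHπ`), PART 29h `EriceCurvatureFormTorusPullback` (the family: `hy` ∕ `hP` ∕ `hSp`, `mem_cube_iff`), PART 29i
`EriceCurvatureFormHessianCovarianceWitness` (`hess_eq_sum_support`; the reflection half), PART 29b `EriceCurvatureFormTorusCurl` (`curl_perm_sorted`,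
`comp_perm_add_e`, `min_lt_max_perm`, `sort_perm_sort_symm`).

WHAT IS KERNEL-CHECKED HERE (def-free; [folklore]):
* §1 `corner_perm` (y(s∘σ⁻¹)_i = y(s)_{σ⁻¹i}), **`comp_perm_mem_cube`** (z ∈ cube(s∘σ⁻¹) ↔ z∘σ ∈ cube(s)), `e_min_add_e_max`,
  **`perm_pullback_mem_support`** (the block's `hSπ`), `perm_perm_symm` (the block's `hππ`).
* §2 `perm_pullback_pullback` (the two pull-backs for σ and σ⁻¹ invert each other), **`hess_transport_perm`** (the block's `hHπ`:
  Hs_{π_σ s}(πA, πA′) = Hs_s(A, A′) — the plaquette law of the permuted curl, sign² = 1, re-indexing).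
HONEST: a toy family; no claim about Bałaban's kernels; NOT N5 for the model, NOT (3.36), NOT B12 Thm 2, NOT BetaPertH, NOT continuum, NOT
Clay.  HONEST DEPENDENCY: continuum YM on T⁴ ⇐ BetaPertH ∧ nine spine estimates (0/9 proved); BetaPertH ⇐ (D1) ∧ (D4) ∧ CAP+tail; G-an2-4
gates asym, D1 and NE2/3/4.
-/

namespace Summit.QuantumFields.BalabanUV.Beta.EriceCurvatureFormHessianCovarianceWitnessPerm

open scoped BigOperators
open Finset
open Literature.MathematicalPhysics.QuantumFieldTheory.Balaban1983to89
open Literature.MathematicalPhysics.QuantumFieldTheory.Balaban1983to89.B7Prop1Explicit (e e_apply)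
open Summit.QuantumFields.BalabanUV.Beta.EriceCurvatureFormTorusCurl
  (curl_perm_sorted comp_perm_add_e min_lt_max_perm sort_perm_sort_symm)
open Summit.QuantumFields.BalabanUV.Beta.EriceCurvatureFormTorusPullback (mem_cube_iff)
open Summit.QuantumFields.BalabanUV.Beta.EriceCurvatureFormHessianCovarianceWitness (hess_eq_sum_support)

variable {d : ℕ} {N m : ℤ}

/-! ## §1. The permuted cube and its plaquettes (the block's `hSπ`, `hππ`) -/

/-- The corner of the permuted cube: y(s∘σ⁻¹)_i = y(s)_{σ⁻¹ i}. [folklore] -/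
theorem corner_perm (y : (Fin d → Bool) → Fin d → ℤ) (hy : ∀ s i, y s i = if s i then N - 1 - m else 1)
    (σ : Equiv.Perm (Fin d)) (s : Fin d → Bool) (i : Fin d) : y (s ∘ σ.symm) i = y s (σ.symm i) := by
  rw [hy, hy, Function.comp_apply]

/-- **z lies in the permuted cube iff z∘σ lies in the cube.** [folklore] -/
theorem comp_perm_mem_cube (y : (Fin d → Bool) → Fin d → ℤ) (hy : ∀ s i, y s i = if s i then N - 1 - m else 1)
    (P : (Fin d → Bool) → Finset (Fin d → ℤ)) (hP : ∀ s, P s = Fintype.piFinset (fun i => Finset.Icc (y s i) (y s i + m)))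
    (σ : Equiv.Perm (Fin d)) (s : Fin d → Bool) (z : Fin d → ℤ) :
    z ∈ P (s ∘ σ.symm) ↔ z ∘ σ ∈ P s := by
  rw [hP, hP, mem_cube_iff, mem_cube_iff]
  constructor
  · intro h j
    have := h (σ j)
    rw [corner_perm y hy, Equiv.symm_apply_apply] at this
    simpa [Function.comp_apply] using this
  · intro h i
    have := h (σ.symm i)
    simp only [Function.comp_apply, Equiv.apply_symm_apply] at this
    rw [corner_perm y hy]
    exact this

/-- e_{min(a,b)} + e_{max(a,b)} = e_a + e_b. [folklore] -/
theorem e_min_add_e_max (a b : Fin d) : (e (min a b) + e (max a b) : Fin d → ℤ) = e a + e b := by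
  rcases le_total a b with h | h
  · rw [min_eq_left h, max_eq_right h]
  · rw [min_eq_right h, max_eq_left h, add_comm]

/-- **THE BLOCK's `hSπ` FOR THE CUBE FAMILY.**  With π_σ s = s∘σ⁻¹ (`hπ`): a plaquette (y,ℓ′) inside the cube π_σ s pulls back to the
plaquette (y∘σ, sort(σ⁻¹ℓ′)) inside the cube s. [folklore] -/
theorem perm_pullback_mem_support (y : (Fin d → Bool) → Fin d → ℤ) (hy : ∀ s i, y s i = if s i then N - 1 - m else 1)
    (P : (Fin d → Bool) → Finset (Fin d → ℤ)) (hP : ∀ s, P s = Fintype.piFinset (fun i => Finset.Icc (y s i) (y s i + m)))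
    (Sp : (Fin d → Bool) → Finset ((Fin d → ℤ) × {o : Fin d × Fin d // o.1 < o.2}))
    (hSp : ∀ s q, q ∈ Sp s ↔ (q.1 ∈ P s ∧ q.1 + e q.2.1.1 + e q.2.1.2 ∈ P s))
    (π : Equiv.Perm (Fin d) → (Fin d → Bool) → (Fin d → Bool)) (hπ : ∀ σ s, π σ s = s ∘ σ.symm)
    (σ : Equiv.Perm (Fin d)) (s : Fin d → Bool) :
    ∀ q ∈ Sp (π σ s),
      (q.1 ∘ σ, (⟨(min (σ.symm q.2.1.1) (σ.symm q.2.1.2), max (σ.symm q.2.1.1) (σ.symm q.2.1.2)),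
        min_lt_max_perm σ.symm q.2.2⟩ : {o : Fin d × Fin d // o.1 < o.2})) ∈ Sp s := by
  intro q hq
  rw [hπ] at hq
  obtain ⟨h1, h2⟩ := (hSp _ _).1 hq
  rw [hSp]
  refine ⟨(comp_perm_mem_cube y hy P hP σ s q.1).1 h1, ?_⟩
  have h2' := (comp_perm_mem_cube y hy P hP σ s _).1 h2
  rw [comp_perm_add_e, comp_perm_add_e] at h2'
  simp only
  rw [add_assoc, e_min_add_e_max, ← add_assoc]
  exact h2'

/-- **The block's `hππ` for the cube family**: π_{σ⁻¹}(π_σ s) = s. [folklore] -/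
theorem perm_perm_symm (π : Equiv.Perm (Fin d) → (Fin d → Bool) → (Fin d → Bool)) (hπ : ∀ σ s, π σ s = s ∘ σ.symm)
    (σ : Equiv.Perm (Fin d)) (s : Fin d → Bool) : π σ.symm (π σ s) = s := by
  rw [hπ, hπ]; funext i; simp

/-! ## §2. Transport of the Hessians under the axis permutations (the block's `hHπ`) -/

/-- The pull-backs for σ and σ⁻¹ invert each other on plaquettes with sorted labels. [folklore] -/
theorem perm_pullback_pullback (σ : Equiv.Perm (Fin d)) (q : (Fin d → ℤ) × {o : Fin d × Fin d // o.1 < o.2}) :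
    (((q.1 ∘ σ) ∘ σ.symm,
      (⟨(min (σ.symm.symm (min (σ.symm q.2.1.1) (σ.symm q.2.1.2))) (σ.symm.symm (max (σ.symm q.2.1.1) (σ.symm q.2.1.2))),
         max (σ.symm.symm (min (σ.symm q.2.1.1) (σ.symm q.2.1.2))) (σ.symm.symm (max (σ.symm q.2.1.1) (σ.symm q.2.1.2)))),
        min_lt_max_perm σ.symm.symm (min_lt_max_perm σ.symm q.2.2)⟩ : {o : Fin d × Fin d // o.1 < o.2}))
      : (Fin d → ℤ) × {o : Fin d × Fin d // o.1 < o.2}) = q := by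
  refine Prod.ext ?_ (Subtype.ext ?_)
  · funext i; simp
  · simp only [Equiv.symm_symm]
    exact sort_perm_sort_symm σ q.2.2

/-- **THE BLOCK's `hHπ` FOR THE CUBE FAMILY: transport of the Hessians under the axis permutations.**  For the ultralocal kernels
K_s(q,q′) = b·[q = q′ ∈ Sp_s] with their factorized Hessians (PART 29i `hess_eq_sum_support`) and π_σ s = s∘σ⁻¹:
Hs_{π_σ s}(πA, πA′) = Hs_s(A, A′) for all bond fields A, A′, (πA)_c(y) = A_{σ⁻¹c}(y∘σ) — by PART 29b's `curl_perm_sorted` (sign² = 1) and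
re-indexing Sp_{π_σ s} along the pull-back (inverse: the pull-back for σ⁻¹). [folklore] -/
theorem hess_transport_perm (y : (Fin d → Bool) → Fin d → ℤ) (hy : ∀ s i, y s i = if s i then N - 1 - m else 1)
    (P : (Fin d → Bool) → Finset (Fin d → ℤ)) (hP : ∀ s, P s = Fintype.piFinset (fun i => Finset.Icc (y s i) (y s i + m)))
    (Sp : (Fin d → Bool) → Finset ((Fin d → ℤ) × {o : Fin d × Fin d // o.1 < o.2}))
    (hSp : ∀ s q, q ∈ Sp s ↔ (q.1 ∈ P s ∧ q.1 + e q.2.1.1 + e q.2.1.2 ∈ P s))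
    (π : Equiv.Perm (Fin d) → (Fin d → Bool) → (Fin d → Bool)) (hπ : ∀ σ s, π σ s = s ∘ σ.symm) (b : ℝ)
    (K : (Fin d → Bool) → (Fin d → ℤ) × {o : Fin d × Fin d // o.1 < o.2} → (Fin d → ℤ) × {o : Fin d × Fin d // o.1 < o.2} → ℝ)
    (hK : ∀ s q q', K s q q' = if (q = q' ∧ q ∈ Sp s) then b else 0)
    (cu : ((Fin d → ℤ) → Fin d → ℝ) → (Fin d → ℤ) → Fin d × Fin d → ℝ)
    (hcu : ∀ A x o, cu A x o = A x o.1 + A (x + e o.1) o.2 - A (x + e o.2) o.1 - A x o.2)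
    (Hs : (Fin d → Bool) → ((Fin d → ℤ) → Fin d → ℝ) → ((Fin d → ℤ) → Fin d → ℝ) → ℝ)
    (hHs : ∀ s A A', Hs s A A' = ∑ x ∈ P s, ∑ o : {o : Fin d × Fin d // o.1 < o.2}, ∑ x' ∈ P s,
      ∑ o' : {o : Fin d × Fin d // o.1 < o.2}, K s (x, o) (x', o') * cu A x o.1 * cu A' x' o'.1)
    (σ : Equiv.Perm (Fin d)) (s : Fin d → Bool) (A A' : (Fin d → ℤ) → Fin d → ℝ) :
    Hs (π σ s) (fun x c => A (x ∘ σ) (σ.symm c)) (fun x c => A' (x ∘ σ) (σ.symm c)) = Hs s A A' := by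
  have hSpP : ∀ s, ∀ q ∈ Sp s, q.1 ∈ P s := fun s q hq => ((hSp s q).1 hq).1
  rw [hess_eq_sum_support P Sp hSpP b K hK cu Hs hHs, hess_eq_sum_support P Sp hSpP b K hK cu Hs hHs]
  congr 1
  -- the plaquette law of the permuted curls, sign squared away
  have hlaw : ∀ q : (Fin d → ℤ) × {o : Fin d × Fin d // o.1 < o.2},
      cu (fun x c => A (x ∘ σ) (σ.symm c)) q.1 q.2.1 * cu (fun x c => A' (x ∘ σ) (σ.symm c)) q.1 q.2.1
      = cu A (q.1 ∘ σ) (min (σ.symm q.2.1.1) (σ.symm q.2.1.2), max (σ.symm q.2.1.1) (σ.symm q.2.1.2))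
        * cu A' (q.1 ∘ σ) (min (σ.symm q.2.1.1) (σ.symm q.2.1.2), max (σ.symm q.2.1.1) (σ.symm q.2.1.2)) := by
    intro q
    rw [curl_perm_sorted σ A _ (fun _ _ => rfl) (fun x p => cu A x p) (fun x p => cu _ x p) (fun x p => hcu A x p)
        (fun x p => hcu _ x p) q.1 q.2.1,
      curl_perm_sorted σ A' _ (fun _ _ => rfl) (fun x p => cu A' x p) (fun x p => cu _ x p) (fun x p => hcu A' x p)
        (fun x p => hcu _ x p) q.1 q.2.1]
    have hs : (if σ.symm q.2.1.1 < σ.symm q.2.1.2 then (1 : ℝ) else -1) * (if σ.symm q.2.1.1 < σ.symm q.2.1.2 then (1 : ℝ) else -1)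
        = 1 := by split_ifs <;> norm_num
    calc (if σ.symm q.2.1.1 < σ.symm q.2.1.2 then (1 : ℝ) else -1)
            * cu A (q.1 ∘ σ) (min (σ.symm q.2.1.1) (σ.symm q.2.1.2), max (σ.symm q.2.1.1) (σ.symm q.2.1.2))
          * ((if σ.symm q.2.1.1 < σ.symm q.2.1.2 then (1 : ℝ) else -1)
            * cu A' (q.1 ∘ σ) (min (σ.symm q.2.1.1) (σ.symm q.2.1.2), max (σ.symm q.2.1.1) (σ.symm q.2.1.2)))
        = ((if σ.symm q.2.1.1 < σ.symm q.2.1.2 then (1 : ℝ) else -1) * (if σ.symm q.2.1.1 < σ.symm q.2.1.2 then (1 : ℝ) else -1))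
          * (cu A (q.1 ∘ σ) (min (σ.symm q.2.1.1) (σ.symm q.2.1.2), max (σ.symm q.2.1.1) (σ.symm q.2.1.2))
            * cu A' (q.1 ∘ σ) (min (σ.symm q.2.1.1) (σ.symm q.2.1.2), max (σ.symm q.2.1.1) (σ.symm q.2.1.2))) := by ring
      _ = _ := by rw [hs, one_mul]
  rw [Finset.sum_congr rfl fun q _ => hlaw q]
  symm
  -- re-index Sp_{πs} along the pull-back for σ (inverse: the pull-back for σ⁻¹)
  refine Finset.sum_nbij'
    (fun q => (q.1 ∘ σ.symm, (⟨(min (σ.symm.symm q.2.1.1) (σ.symm.symm q.2.1.2), max (σ.symm.symm q.2.1.1) (σ.symm.symm q.2.1.2)),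
        min_lt_max_perm σ.symm.symm q.2.2⟩ : {o : Fin d × Fin d // o.1 < o.2})))
    (fun q => (q.1 ∘ σ, (⟨(min (σ.symm q.2.1.1) (σ.symm q.2.1.2), max (σ.symm q.2.1.1) (σ.symm q.2.1.2)),
        min_lt_max_perm σ.symm q.2.2⟩ : {o : Fin d × Fin d // o.1 < o.2})))
    ?_ ?_ ?_ ?_ ?_
  · -- Sp_s → Sp_{πs}: the pull-back for σ⁻¹ at the cube π_σ s (π_{σ⁻¹}(π_σ s) = s)
    intro q hq
    have h := perm_pullback_mem_support y hy P hP Sp hSp π hπ σ.symm (π σ s) q (by rw [perm_perm_symm π hπ]; exact hq)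
    exact h
  · intro q hq
    exact perm_pullback_mem_support y hy P hP Sp hSp π hπ σ s q hq
  · intro q _
    have h := perm_pullback_pullback σ.symm q
    simp only [Equiv.symm_symm] at h ⊢
    exact h
  · intro q _
    have h := perm_pullback_pullback σ q
    simp only [Equiv.symm_symm] at h ⊢
    exact h
  · intro q _
    have hsort := sort_perm_sort_symm σ.symm q.2.2
    simp only [Equiv.symm_symm] at hsort
    have hfst : (q.1 ∘ σ.symm) ∘ σ = q.1 := by funext i; simp
    simp only [Equiv.symm_symm, hfst]
    rw [hsort]

end Summit.QuantumFields.BalabanUV.Beta.EriceCurvatureFormHessianCovarianceWitnessPerm
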